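import Summits.QuantumAdvantage.QuantumAdvantage.Theorems.RegisterRotationA

/-! # RegisterRotationB — part 2/4 (mechanical split for landing of `RegisterRotation`; content verbatim; scopes re-opened with their variables) -/

set_option linter.dupNamespace false

namespace Summit.QuantumAdvantage.AdviceFreeQNC0.RegisterRotation
open Classical
open Finset
open Summit.QuantumAdvantage.AdviceFreeQNC0
open Literature.Computability.MetaComplexity Literature.Computability.MetaComplexity.Smolensky
variable {n : ℕ}

section Register
open F4

/-- GROUP LAW in the register: `R_{y ⊕ y'} = R_y + R_{y'}`. -/
theorem reg_xorStrat (y y' : Fin (n + 1) → (Fin n → Bool) → Bool) (u : Fin n → Bool) :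
    reg (xorStrat y y') u = reg y u + reg y' u := by
  unfold reg xorStrat
  rw [← Finset.sum_add_distrib]
  refine Finset.sum_congr rfl fun g _ => ?_
  rw [iotaF_xor, add_mul]

/-- SCALING LAW in the register: `R_{f·y} = [f]·R_y`. -/
theorem reg_mulStrat (f : (Fin n → Bool) → Bool) (y : Fin (n + 1) → (Fin n → Bool) → Bool) (u : Fin n → Bool) :
    reg (mulStrat f y) u = ιF (f u) * reg y u := by
  unfold reg mulStrat
  rw [Finset.mul_sum]
  refine Finset.sum_congr rfl fun g _ => ?_
  rw [iotaF_and, mul_assoc]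

/-- two strategies whose registers differ by the factor `ω` win at charges shifted by one:
`R_{y'}(u) = ω·R_y(u) ⟹ WIN_c(y')(u) = WIN_{c+1}(y)(u)` for every `c`. -/
theorem ringWinU_of_reg_rotate (c : ℕ) {y y' : Fin (n + 1) → (Fin n → Bool) → Bool} {u : Fin n → Bool}
    (h : reg y' u = ω * reg y u) : ringWinU c y' u = ringWinU (c + 1) y u := by
  apply iotaF_injective
  rw [iotaF_ringWinU_reg, iotaF_ringWinU_reg, h, pow_succ ω c]
  congr 1
  ring

/-- the register as a sum over the fired cuts only. -/
theorem reg_eq_sum_filter (y : Fin (n + 1) → (Fin n → Bool) → Bool) (u : Fin n → Bool) :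
    reg y u = ∑ g ∈ univ.filter (fun g : Fin (n + 1) => y g u = true), ω ^ (g.val + walkExp u g.val) := by
  unfold reg
  rw [Finset.sum_filter]
  refine Finset.sum_congr rfl fun g _ => ?_
  unfold ιF
  cases y g u <;> simp

end Register

/-! ## §6 THE ROTATION LEMMA (new, g12): `ω·R_y` is, almost everywhere, the register of a strategy of comparable degree

For a cut `g` and an input `u`, the cut `h` nearest to `g` on a fixed side with `e_h(u) ≡ e_g(u) + 1 (mod 3)`
satisfies `ω·ω^{g+e_g} … ` precisely: `ω^{h + e_h(u)} = ω·ω^{g + e_g(u)}`.  Looking for `h` among the `m` cuts to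
the right of `g` (or to the left when `g > n − m`), the search FAILS only on the alternating bit pattern
`u_i = [(i+g) even]` on the whole window (`pattern_of_missR/L`), i.e. on `≤ 2^{n−m}` inputs per cut.  Re-filing every
fired cut `g` of `y` at its target `h = tgt m u g` (XOR on collisions) gives the strategy `rot m y` with
`R_{rot m y}(u) = ω·R_y(u)` off the bad set (`reg_rot`), hence `WIN_c(rot m y) = WIN_{c+1}(y)` there
(`ringWinU_rot`), of degree `≤ (6m+1)·d` (`hasDegF_rot`: `rot m y h` is a Boolean function of the `≤ 2m+1`
selections `y_g`, `|g−h| ≤ m`, and the `≤ 4m` bits `u_i`, `|i−h| < 2m`; landed `ind_mem_lowDeg_of_pattern`). -/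

section Rotation
open F4

/-- number of `1`s of `u` in the window `[a, b)`. -/
def onesIn (u : Fin n → Bool) (a b : ℕ) : ℕ :=
  (univ.filter fun i : Fin n => a ≤ i.val ∧ i.val < b ∧ u i = true).card

/-- the empty window has no ones. -/
theorem onesIn_self (u : Fin n → Bool) (a : ℕ) : onesIn u a a = 0 := by
  unfold onesIn
  rw [Finset.card_eq_zero, Finset.filter_eq_empty_iff]
  intro i _ h
  omega

/-- prefix weights split at an intermediate cut. -/
theorem wtPrefix_add_onesIn (u : Fin n → Bool) {a b : ℕ} (hab : a ≤ b) :
    wtPrefix u b = wtPrefix u a + onesIn u a b := by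
  unfold wtPrefix onesIn
  rw [← Finset.card_union_of_disjoint]
  · congr 1
    ext i
    simp only [mem_filter, mem_univ, true_and, mem_union]
    constructor
    · rintro ⟨h1, h2⟩
      by_cases hi : i.val < a
      · exact Or.inl ⟨hi, h2⟩
      · exact Or.inr ⟨by omega, h1, h2⟩
    · rintro (⟨h1, h2⟩ | ⟨h1, h2, h3⟩)
      · exact ⟨by omega, h2⟩
      · exact ⟨h2, h3⟩
  · rw [Finset.disjoint_filter]
    intro i _ h1 h2
    omega

/-- the windows agree if the bits in them agree. -/
theorem onesIn_congr {u v : Fin n → Bool} {a b : ℕ} (h : ∀ i : Fin n, a ≤ i.val → i.val < b → u i = v i) :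
    onesIn u a b = onesIn v a b := by
  unfold onesIn
  congr 1
  apply Finset.filter_congr
  intro i _
  constructor
  · rintro ⟨h1, h2, h3⟩
    exact ⟨h1, h2, (h i h1 h2) ▸ h3⟩
  · rintro ⟨h1, h2, h3⟩
    exact ⟨h1, h2, (h i h1 h2).symm ▸ h3⟩

/-- extend a window by one bit on the right. -/
theorem onesIn_succ_right (u : Fin n → Bool) {a b : ℕ} (hab : a ≤ b) (hb : b < n) :
    onesIn u a (b + 1) = onesIn u a b + (if u ⟨b, hb⟩ = true then 1 else 0) := by
  have h1 := wtPrefix_add_onesIn u (show a ≤ b + 1 by omega)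
  have h2 := wtPrefix_add_onesIn u hab
  have h3 := Summit.QuantumAdvantage.QuantumAdvantage.Theorems.PairFreezing.wtPrefix_succ u hb
  omega

/-- extend a window by one bit on the left. -/
theorem onesIn_pred_left (u : Fin n → Bool) {a b : ℕ} (hab : a + 1 ≤ b) (ha : a < n) :
    onesIn u a b = (if u ⟨a, ha⟩ = true then 1 else 0) + onesIn u (a + 1) b := by
  have h1 := wtPrefix_add_onesIn u (show a ≤ b by omega)
  have h2 := wtPrefix_add_onesIn u hab
  have h3 := Summit.QuantumAdvantage.QuantumAdvantage.Theorems.PairFreezing.wtPrefix_succ u ha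
  omega

/-- the window offsets `j ∈ [1, m]` at which cut `g + j` ROTATES cut `g` at `u` (walk exponent one more, mod 3). -/
def candR (m : ℕ) (u : Fin n → Bool) (g : ℕ) : Finset ℕ :=
  (Finset.Icc 1 m).filter fun j => (j + onesIn u g (g + j)) % 3 = 1

/-- the window offsets `j ∈ [1, m]` at which cut `g − j` rotates cut `g` at `u`. -/
def candL (m : ℕ) (u : Fin n → Bool) (g : ℕ) : Finset ℕ :=
  (Finset.Icc 1 m).filter fun j => (j + onesIn u (g - j) g) % 3 = 2

/-- some cut `g + j`, `1 ≤ j ≤ m`, rotates cut `g` at `u`. -/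
def goodR (m : ℕ) (u : Fin n → Bool) (g : ℕ) : Bool := !((candR m u g).card == 0)

/-- some cut `g − j`, `1 ≤ j ≤ m`, rotates cut `g` at `u`. -/
def goodL (m : ℕ) (u : Fin n → Bool) (g : ℕ) : Bool := !((candL m u g).card == 0)

/-- `goodR` unfolds to the existence of a rotating offset to the right. -/
theorem goodR_iff {m : ℕ} {u : Fin n → Bool} {g : ℕ} :
    goodR m u g = true ↔ ∃ j, 1 ≤ j ∧ j ≤ m ∧ (j + onesIn u g (g + j)) % 3 = 1 := by
  unfold goodR candR
  rw [Bool.not_eq_true', beq_eq_false_iff_ne, ne_eq, Finset.card_eq_zero, ← ne_eq,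
    ← Finset.nonempty_iff_ne_empty, Finset.filter_nonempty_iff]
  simp only [Finset.mem_Icc, and_assoc]

/-- `goodL` unfolds to the existence of a rotating offset to the left. -/
theorem goodL_iff {m : ℕ} {u : Fin n → Bool} {g : ℕ} :
    goodL m u g = true ↔ ∃ j, 1 ≤ j ∧ j ≤ m ∧ (j + onesIn u (g - j) g) % 3 = 2 := by
  unfold goodL candL
  rw [Bool.not_eq_true', beq_eq_false_iff_ne, ne_eq, Finset.card_eq_zero, ← ne_eq,
    ← Finset.nonempty_iff_ne_empty, Finset.filter_nonempty_iff]
  simp only [Finset.mem_Icc, and_assoc]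

/-- cut `g` can be rotated at `u` within the window `m` (to the right if there is room, else to the left). -/
def good (m : ℕ) (u : Fin n → Bool) (g : Fin (n + 1)) : Bool :=
  if g.val + m ≤ n then goodR m u g.val else goodL m u g.val

/-- the rotation target of cut `g` at input `u` (itself, if the search fails). -/
noncomputable def tgt (m : ℕ) (u : Fin n → Bool) (g : Fin (n + 1)) : Fin (n + 1) :=
  if hR : g.val + m ≤ n then
    (if h : goodR m u g.val = true then
      ⟨g.val + Nat.find (goodR_iff.mp h), by have := (Nat.find_spec (goodR_iff.mp h)).2.1; omega⟩ else g)
  else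
    (if h : goodL m u g.val = true then ⟨g.val - Nat.find (goodL_iff.mp h), by omega⟩ else g)

/-- exponent bookkeeping, right target. -/
theorem exp_hitR (u : Fin n → Bool) {g j : ℕ} (h : (j + onesIn u g (g + j)) % 3 = 1) :
    (g + j + walkExp u (g + j)) % 3 = (g + walkExp u g + 1) % 3 := by
  unfold walkExp
  have hs := wtPrefix_add_onesIn u (show g ≤ g + j by omega)
  omega

/-- exponent bookkeeping, left target. -/
theorem exp_hitL (u : Fin n → Bool) {g j : ℕ} (hjg : j ≤ g) (h : (j + onesIn u (g - j) g) % 3 = 2) :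
    (g - j + walkExp u (g - j)) % 3 = (g + walkExp u g + 1) % 3 := by
  unfold walkExp
  have hs := wtPrefix_add_onesIn u (show g - j ≤ g by omega)
  omega

/-- the target rotates: `e_{tgt}(u) + tgt ≡ e_g(u) + g + 1 (mod 3)` whenever `g` is good at `u`. -/
theorem tgt_spec {m : ℕ} (hm : 2 * m ≤ n) (u : Fin n → Bool) (g : Fin (n + 1)) (hg : good m u g = true) :
    ((tgt m u g).val + walkExp u (tgt m u g).val) % 3 = (g.val + walkExp u g.val + 1) % 3 := by
  unfold good at hg
  unfold tgt
  by_cases hR : g.val + m ≤ n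
  · rw [if_pos hR] at hg
    rw [dif_pos hR, dif_pos hg]
    have hs := Nat.find_spec (goodR_iff.mp hg)
    exact exp_hitR u hs.2.2
  · rw [if_neg hR] at hg
    rw [dif_neg hR, dif_pos hg]
    have hs := Nat.find_spec (goodL_iff.mp hg)
    have hg' : g.val ≤ n := Nat.lt_succ_iff.mp g.isLt
    exact exp_hitL u (by omega) hs.2.2

/-- the target is within distance `m` of the cut. -/
theorem tgt_near (m : ℕ) (u : Fin n → Bool) (g : Fin (n + 1)) :
    (tgt m u g).val ≤ g.val + m ∧ g.val ≤ (tgt m u g).val + m := by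
  unfold tgt
  by_cases hR : g.val + m ≤ n
  · rw [dif_pos hR]
    by_cases h : goodR m u g.val = true
    · rw [dif_pos h]
      have hs := Nat.find_spec (goodR_iff.mp h)
      constructor
      · show g.val + Nat.find (goodR_iff.mp h) ≤ g.val + m
        omega
      · show g.val ≤ g.val + Nat.find (goodR_iff.mp h) + m
        omega
    · rw [dif_neg h]
      constructor <;> omega
  · rw [dif_neg hR]
    by_cases h : goodL m u g.val = true
    · rw [dif_pos h]
      have hs := Nat.find_spec (goodL_iff.mp h)
      constructor
      · show g.val - Nat.find (goodL_iff.mp h) ≤ g.val + m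
        omega
      · show g.val ≤ g.val - Nat.find (goodL_iff.mp h) + m
        omega
    · rw [dif_neg h]
      constructor <;> omega

/-- `Nat.find` of pointwise-equivalent predicates agree. -/
theorem nat_find_eq_of_iff {P Q : ℕ → Prop} [DecidablePred P] [DecidablePred Q] (hP : ∃ j, P j)
    (hQ : ∃ j, Q j) (h : ∀ j, P j ↔ Q j) : Nat.find hP = Nat.find hQ := by
  apply le_antisymm
  · exact Nat.find_min' hP ((h _).mpr (Nat.find_spec hQ))
  · exact Nat.find_min' hQ ((h _).mp (Nat.find_spec hP))

/-- LOCALITY: the target of `g` depends only on the bits at distance `< m` from `g`. -/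
theorem tgt_local (m : ℕ) {u v : Fin n → Bool} (g : Fin (n + 1))
    (huv : ∀ i : Fin n, g.val ≤ i.val + m → i.val < g.val + m → u i = v i) : tgt m u g = tgt m v g := by
  have hRiff : ∀ j, j ≤ m →
      ((j + onesIn u g.val (g.val + j)) % 3 = 1 ↔ (j + onesIn v g.val (g.val + j)) % 3 = 1) := by
    intro j hj
    rw [onesIn_congr (u := u) (v := v) (a := g.val) (b := g.val + j)
      (fun i h1 h2 => huv i (by omega) (by omega))]
  have hLiff : ∀ j, j ≤ m →
      ((j + onesIn u (g.val - j) g.val) % 3 = 2 ↔ (j + onesIn v (g.val - j) g.val) % 3 = 2) := by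
    intro j hj
    rw [onesIn_congr (u := u) (v := v) (a := g.val - j) (b := g.val)
      (fun i h1 h2 => huv i (by omega) (by omega))]
  have hexR : (∃ j, 1 ≤ j ∧ j ≤ m ∧ (j + onesIn u g.val (g.val + j)) % 3 = 1) ↔
      (∃ j, 1 ≤ j ∧ j ≤ m ∧ (j + onesIn v g.val (g.val + j)) % 3 = 1) :=
    exists_congr fun j => ⟨fun ⟨h1, h2, h3⟩ => ⟨h1, h2, (hRiff j h2).mp h3⟩,
      fun ⟨h1, h2, h3⟩ => ⟨h1, h2, (hRiff j h2).mpr h3⟩⟩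
  have hexL : (∃ j, 1 ≤ j ∧ j ≤ m ∧ (j + onesIn u (g.val - j) g.val) % 3 = 2) ↔
      (∃ j, 1 ≤ j ∧ j ≤ m ∧ (j + onesIn v (g.val - j) g.val) % 3 = 2) :=
    exists_congr fun j => ⟨fun ⟨h1, h2, h3⟩ => ⟨h1, h2, (hLiff j h2).mp h3⟩,
      fun ⟨h1, h2, h3⟩ => ⟨h1, h2, (hLiff j h2).mpr h3⟩⟩
  have hGR : (goodR m u g.val = true) ↔ (goodR m v g.val = true) := goodR_iff.trans (hexR.trans goodR_iff.symm)
  have hGL : (goodL m u g.val = true) ↔ (goodL m v g.val = true) := goodL_iff.trans (hexL.trans goodL_iff.symm)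
  unfold tgt
  by_cases hR : g.val + m ≤ n
  · rw [dif_pos hR, dif_pos hR]
    by_cases h : goodR m u g.val = true
    · have h' : goodR m v g.val = true := hGR.mp h
      rw [dif_pos h, dif_pos h']
      apply Fin.ext
      show g.val + Nat.find (goodR_iff.mp h) = g.val + Nat.find (goodR_iff.mp h')
      rw [nat_find_eq_of_iff (goodR_iff.mp h) (goodR_iff.mp h')
        (fun j => ⟨fun ⟨h1, h2, h3⟩ => ⟨h1, h2, (hRiff j h2).mp h3⟩,
          fun ⟨h1, h2, h3⟩ => ⟨h1, h2, (hRiff j h2).mpr h3⟩⟩)]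
    · have h' : ¬ goodR m v g.val = true := fun hv => h (hGR.mpr hv)
      rw [dif_neg h, dif_neg h']
  · rw [dif_neg hR, dif_neg hR]
    by_cases h : goodL m u g.val = true
    · have h' : goodL m v g.val = true := hGL.mp h
      rw [dif_pos h, dif_pos h']
      apply Fin.ext
      show g.val - Nat.find (goodL_iff.mp h) = g.val - Nat.find (goodL_iff.mp h')
      rw [nat_find_eq_of_iff (goodL_iff.mp h) (goodL_iff.mp h')
        (fun j => ⟨fun ⟨h1, h2, h3⟩ => ⟨h1, h2, (hLiff j h2).mp h3⟩,
          fun ⟨h1, h2, h3⟩ => ⟨h1, h2, (hLiff j h2).mpr h3⟩⟩)]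
    · have h' : ¬ goodL m v g.val = true := fun hv => h (hGL.mpr hv)
      rw [dif_neg h, dif_neg h']


end Rotation
end Summit.QuantumAdvantage.AdviceFreeQNC0.RegisterRotation
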